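import Literature.MathematicalPhysics.QuantumFieldTheory.Balaban1983to89.B9Eq39Adjoint

/-!
# `Balaban1983to89.B9Eq310Hermitian` — the operator `Δ^η(U) = D*D_U + Δ′` of B9 (3.10), p. 392, TYPED AS AN OPERATOR on
# bond fields: its form IS the printed `⟨A,ΔA⟩`, it is SYMMETRIC («a hermitian operator» on the unitary group), and `Δ′` is
# BOUNDED AND SMALL when `η⁻²|U(∂p) − 1|` is («a bounded, small operator»); kernel-checked; v1

CITATION HEADER (lean-in-tree rule).  Audit cell `pub-balaban`, surge node-prover lineage pv27 (B9 pp. 390–392), unit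
`b2b-balaban-pv27-g16` (journal CLAIM l.53170, node B9-EQ310-HERMITIAN).  Source: T. Bałaban, *Propagators for lattice gauge
theories in a background field*, Commun. Math. Phys. **99** (1985) 389–434 [Balaban1985BackgroundPropagators] (cell paper B9;
journal page = PDF page + 388), p. 392 [PDF 4], quoted from the page render
`b2b-balaban-ref1/pages/1985-cmp99-background-propagators/…-p004-x2.png` READ AS AN IMAGE by this lineage (2026-08-19); the
displays (3.1)–(3.9), (3.11), (3.12) are quoted in full in the header of the imported leaf `B9Eq39Adjoint` (same lineage, v1).

HONEST FRAMING (cell charter, verbatim in substance).  The cell audits Bałaban's papers; discharging its end statements would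
make Bałaban's ultraviolet stability theorem unconditional inside this package — a constructive-QFT statement; it is NOT the
continuum limit and NOT the Clay problem.  THIS FILE DISCHARGES NOTHING of the series: it is finite non-commutative algebra
(summation by parts over a finite site set with bijective shifts, trace cyclicity, an involution) and one triangle-inequality
count, on top of the lineage leaf `B9Eq39Adjoint` (imported BY NAME: `R`, `covD`, `covDstar`, `curl`, `divP`, `plaqU`,
`lettersA`, `posPlaq`, `curlη`, `divPη`, `bondPair`, `deltaPrime`, `hessPair`, (3.9) = `sum_curl_mul` / `sum_posPlaq_curl_mul`).
That leaf typed `⟨A,Δ′A⟩` and `⟨A,ΔA⟩` of (3.10) as QUADRATIC FORMS (numbers) and stated in its header «NOT PROVED HERE: anything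
about Δ^η(U) as an OPERATOR (hermiticity on U(N), …, the smallness of Δ′ …)».  This file types the OPERATOR and proves exactly the
three things the printed sentence around (3.10) says about it, in the generality the algebra allows.  Value = kernel certificate
of a located printed display + typed objects (`deltaPrimeOp`, `deltaOp`, the letter divergence `divL`) consumers can import; NOT
summit progress.

ABSOLUTE RULE.  No internally-minted statement enters as a cited fact.  Every declaration below is PROVED (tags `[folklore]`);
the `[cite: …]` tags document WHICH PRINTED DISPLAY a definition or a proved statement transcribes — the proofs are ours, the
print is not used as a hypothesis anywhere.  The smallness parameter `δ` of §5 is a HYPOTHESIS of the bound (B9 obtains it from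
the regularity condition (3.35), p. 396 — quoted as the source of the assumption, not derived and not cited as a fact).

WHAT IS IN PRINT (p. 392 [PDF 4]; «…» verbatim from the render).  After (3.9): «The quadratic terms in the expansion (3.7)
define the basic operator generalizing the operator ∂*∂ in the Abelian case. We denote it by Δ^η(U), or simply by Δ. For U with
values in the unitary group U(N) it is a hermitian operator given by the quadratic form ⟨A,ΔA⟩ = ⟨A,D*DA⟩ + ⟨A,Δ′A⟩,
⟨A,Δ′A⟩ = Σ_{p⊂T_η} η^d tr((D¹_U A)(p))² η⁻²(Re U(∂p) − 1) + tr Σ_{b₁,b₂⊂∂(p)_z, b₁≺b₂} i[A′(b₁), A′(b₂)]η⁻² Im U(∂p). (3.10)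
We have written it this way because with our assumptions on the configuration U the operator Δ′ will be a bounded, small
operator, which will be treated as a small perturbation of D*D.  Let us write the linear term in (3.7) as ⟨A,J⟩ = Σ_{b⊂T_η} η^d
tr A(b)J(b), (3.11)»; p. 391 [PDF 3]: «The adjoints are taken with respect to natural L² scalar products for functions with
values in N × N hermitian matrices.»

WHAT THIS FILE PROVES.  MODEL (as in `B9Eq39Adjoint`): `𝔸` a ring (a ℂ-algebra from §2 on; normed in §§3, 5; with a
`StarRing`/`StarModule ℂ` involution in §4), `R U X = U·X·U⁻¹`; sites `S` (finite where sums occur), directions `ι` (finite,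
linearly ordered), shifts `T μ : S ≃ S` (bijections; NO commutation assumed), configuration `U : ι → S → 𝔸ˣ`, bond fields
`A : ι → S → 𝔸` (`A μ x = A(x, x+ηe_μ)`), plaquette functions `F : ι → ι → S → 𝔸` on `p_{μν}(x)`, `μ < ν`; `τ` additive and
tracial (`τ(ab) = τ(ba)`; ℂ-linear `𝔸 →ₗ[ℂ] ℂ` where the pairing `⟨A,E⟩ = η^d Σ_b τ(A(b)E(b))` = `bondPair` of (3.11) occurs).
* §1 THE LETTER DIVERGENCE `divL T U G₁ G₂ G₃ G₄` — the adjoint of `B ↦ (B′₁(p), …, B′₄(p))` (the four transported letters of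
  (3.2)/(3.4), `lettersA`) when EACH letter is paired with its own plaquette function: **`sum_letters_mul`**
  `Σ_x Σ_{μ<ν} Σ_k τ(B′_k(p_{μν}(x))·G_k(p_{μν}(x))) = Σ_x Σ_μ τ(B_μ(x)·(÷G)_μ(x))` (exact background, any ring); `divL F F F F =
  divP F` is (3.9) definitionally (`divL_self`), whence `divP_add`; two trace identities: `trace_jordan_symm` and the symmetry of
  the polarised four-letter commutator pairing `four_letter_symm`.
* §2 THE OPERATORS (ℂ-algebra; the printed weights `z(p) = η⁻²(Re U(∂p) − 1)` = `zP`, `y(p) = η⁻² Im U(∂p)` = `yP`, complexified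
  `Re`/`Im` of p. 391 = `B9Eq37Insertion.reC/imC`): `jordanF A p = ½((D¹_U A)(p)·z(p) + z(p)·(D¹_U A)(p))`; the signed partner
  sums `sgnSumₖ` (`S_k = Σ_{j<k}A′_j − Σ_{j>k}A′_j`) and commutator letter functions `commGₖ A p = (i/2)[y(p), S_k(p)]`;
  **`deltaPrimeOp T U η A μ x = (D*F^J_A)_μ(x) + (÷(G₁,…,G₄)_A)_μ(x)`** = `Δ′`; **`deltaOp = D^{η*}D^η_U + Δ′`** = `Δ`; both
  ADDITIVE and ℂ-HOMOGENEOUS in `A` (`deltaPrimeOp_add/_smul`, `deltaOp_add/_smul`); SYMMETRY for the pairing: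
  **`bondPair_deltaPrimeOp_symm`** `⟨B,Δ′A⟩ = ⟨A,Δ′B⟩` and **`bondPair_deltaOp_symm`** `⟨B,ΔA⟩ = ⟨A,ΔB⟩` (exact background,
  arbitrary units — no unitarity is needed for symmetry; `sum_mul_divP_jordanF_symm`, `sum_mul_divL_commG_symm`,
  `bondPair_divPη_curlη_symm`).
* §3 (normed ℂ-algebra, where `deltaPrime`/`hessPair`/`commSum` live) THE FORM OF THE OPERATOR IS THE PRINTED FORM:
  `four_letter_comm_trace` `Σ_k τ(A′_k·(yS_k − S_ky)) = 2τ((Σ_{j<k}[A′_j,A′_k])·y)`; `sum_mul_divP_jordanF` (first term) and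
  `sum_mul_divL_commG_self` (commutator term); **`bondPair_deltaPrimeOp_self`** `⟨A, Δ′A⟩ = deltaPrime T U η d τ A` and
  **`bondPair_deltaOp_self`** `⟨A, ΔA⟩ = hessPair T U η d τ A` — (3.10) letter for letter; POLARISATION `hessPair_add`,
  `deltaPrime_add`: `Q(A+B) = Q(A) + Q(B) + 2⟨A,ΔB⟩`, i.e. the printed quadratic form determines the symmetric operator.
* §4 ON THE UNITARY GROUP (`(U μ x)⁻¹ = (U μ x)*`, hypothesis `hU`; «U with values in the unitary group U(N)»): `plaqU_unitary`;
  `*` commutes with `R`, `D_μ`, `D*_μ`, `D_U`, `D*`, `÷`, and fixes `z(p)`, `y(p)` (`B9Eq37Insertion.star_reC/imC` BY NAME);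
  **`star_deltaPrimeOp`**, **`star_deltaOp`**: `((ΔA)(b))* = (Δ(A*))(b)`, so `Δ`, `Δ′` preserve hermitian bond fields
  (`deltaOp_selfAdjoint`); for a `*`-compatible tracial `τ` (`τ(a*) = conj τ(a)`) and hermitian `A`, `E`: `conj ⟨A,E⟩ = ⟨A,E⟩`
  (`conj_bondPair`), hence **`conj_hessPair`**, **`hessPair_im`**, `deltaPrime_im`: the printed `⟨A,ΔA⟩`, `⟨A,Δ′A⟩` are REAL.
  Symmetric (§2) + `*`-equivariant + real form = the algebraic content of «it is a hermitian operator».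
* §5 (normed ℂ-algebra) «a bounded, small operator»: with units of norm `≤ 1` whose inverses have norm `≤ 1` (`hU1`; unitary
  matrices in the operator norm), `‖A(b)‖ ≤ a`, and `‖z(p)‖ ≤ δ`, `‖y(p)‖ ≤ δ` on positively oriented plaquettes:
  `norm_curl_le` (`4a`), `norm_jordanF_le` (`4aδ`), `norm_commG_le` (`3aδ`), `norm_divP_le`/`norm_divL_le` (`2f(d−1)`, the
  `d − 1 = #{ν ≠ μ}` plaquettes through a bond each way, `sum_ite_lt_add_sum_ite_gt`), and **`norm_deltaPrimeOp_le`**: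
  `‖(Δ′A)(b)‖ ≤ 14(d−1)·a·δ` at every bond (sup-norm operator bound, linear in `δ`).
* §6 sanity (`U ≡ 1`): `z = y = 0` and `Δ′ = 0`, i.e. `Δ = D*D` («the operator ∂*∂ in the Abelian case»).

RELATED IN THE TREE, NOT DUPLICATED (searched 2026-08-19: `grep -rln "(3.10)\|selfAdjoint\|hermitian" Balaban1983to89/`, MODULE-MAP
rows B8/B9/β): `B9Eq39Adjoint` (this lineage) has the FORMS `deltaPrime`, `hessPair` and (3.12), no operator; `B9Thm311Data` /
`B9Thm311Lattice` (sub-cell b09, Thm 3.11 p. 416) take `Δ^η_U` as an ABSTRACT symmetric real operator (hypothesis `hΔ`) resp. model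
it as `D*cD` on a real finite-dimensional lattice system — the shape `⟨Δx,y⟩ = ⟨x,Δy⟩` is what §2 proves here for the actual (3.10)
operator in the trace-pairing model, but the carriers differ (no instance of their `E` is built here); `Beta.PlaquetteHessian`
symmetrises the FIRST-ORDER-in-`B` Wilson Hessian as a real matrix (`symPart`), background `e^B` truncated, whereas here `U(b)` are
exact units; `B9Thm37GlueTorusUnitary` (pv21) treats `∇_U*∇_U + M_q` for unitary `U` in an ℓ¹ torus model (the `D*D` part only, no
`Δ′`); `B8CurlGradHolonomy`, `B8HessianSupWitness` quote (3.8)–(3.10) in headers only.  None types `Δ′`/`Δ` of (3.10) as an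
operator on bond fields, proves its symmetry / `*`-equivariance / reality, or bounds `Δ′`.

NOT PROVED HERE, NOT CLAIMED: positivity of `D*D` or of `Δ` (Thm 3.11 territory, b09), that (3.35) p. 396 implies the smallness
hypotheses `‖z(p)‖, ‖y(p)‖ ≤ δ` with B9's constants, any statement in the normalised Hilbert–Schmidt norm `|X|² = tr X*X` of p. 392
(the bound of §5 is in the norm of the `NormedRing` instance — e.g. the operator norm on `N × N` matrices, in which unitaries and
their inverses have norm `1`; cell DIVERGENCE D-1: the HS norm is transport-invariant but submultiplicative only up to `√N`), the
self-adjointness of `Δ` as an operator on the real Hilbert space of hermitian bond fields with the HS inner product (what is proved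
is symmetry for the complex-bilinear trace pairing (3.11), `*`-equivariance, and reality of the form — the reader assembles these),
the propagators, the averaging operators (3.13)ff, or any theorem of the series; the identification of `(S, T, ι)` with `T_η` and of
`τ` with the normalised matrix trace is the reader's (DIVERGENCE D-pv27.5).  Records: GAPS C-pv27-69.  NOT summit progress.
-/

noncomputable section

open NormedSpace Complex

namespace Literature.MathematicalPhysics.QuantumFieldTheory.Balaban1983to89.B9Eq310Hermitian

open Literature.MathematicalPhysics.QuantumFieldTheory.Balaban1983to89.Beta.TransportVertices
open Literature.MathematicalPhysics.QuantumFieldTheory.Balaban1983to89.B9Eq37Insertion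
open Literature.MathematicalPhysics.QuantumFieldTheory.Balaban1983to89.B9Eq39Adjoint

/-! ## §1  The letter divergence `divL` — the adjoint of `B ↦ (B′(b))_{b⊂∂p}` — and two trace identities -/

section LetterDiv

variable {𝔸 : Type*} [Ring 𝔸] {S : Type*} {ι : Type*} [Fintype ι] [LinearOrder ι]
variable (T : ι → Equiv.Perm S) (U : ι → S → 𝔸ˣ)

/-- THE LETTER DIVERGENCE.  A plaquette term of (3.10) pairs each of the four transported letters `B′(b)`, `b ⊂ ∂(p)_z`, of a
bond field `B` (`lettersA`: `−R(U_ν(x))B_μ(x+e_ν)`, `−B_ν(x)`, `B_μ(x)`, `R(U_μ(x))B_ν(x+e_μ)` for `p = p_{μν}(x)`, `μ < ν`)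
with its OWN plaquette function `G₁, …, G₄`.  Collecting, for a fixed bond `⟨x, x+e_μ⟩`, the positively oriented plaquettes
through it gives the bond function
`(÷G)_μ(x) = Σ_{ν<μ}(R(U_ν(x−e_ν))⁻¹G₄_{νμ}(x−e_ν) − G₂_{νμ}(x)) − Σ_{ν>μ}(R(U_ν(x−e_ν))⁻¹G₁_{μν}(x−e_ν) − G₃_{μν}(x))`,
which for `G₁ = G₂ = G₃ = G₄ = F` is, letter for letter, the first form of `(D*F)_μ(x)` in (3.9) (`divL_self`). [folklore]
[cite: Balaban1985BackgroundPropagators, (3.9) p.392, (3.10) p.392] -/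
def divL (G₁ G₂ G₃ G₄ : ι → ι → S → 𝔸) (μ : ι) (x : S) : 𝔸 :=
  (∑ ν, if ν < μ then R (U ν ((T ν).symm x))⁻¹ (G₄ ν μ ((T ν).symm x)) - G₂ ν μ x else 0)
    - ∑ ν, if μ < ν then R (U ν ((T ν).symm x))⁻¹ (G₁ μ ν ((T ν).symm x)) - G₃ μ ν x else 0

/-- On the diagonal the letter divergence IS the plaquette adjoint `D*` of (3.9): `÷(F,F,F,F) = D*F`, definitionally.
[folklore] [cite: Balaban1985BackgroundPropagators, (3.9) p.392] -/
theorem divL_self (F : ι → ι → S → 𝔸) (μ : ι) (x : S) : divL T U F F F F μ x = divP T U F μ x := rfl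

/-- `÷` is additive in its four slots jointly. [folklore] -/
theorem divL_add (G₁ G₂ G₃ G₄ H₁ H₂ H₃ H₄ : ι → ι → S → 𝔸) (μ : ι) (x : S) :
    divL T U (G₁ + H₁) (G₂ + H₂) (G₃ + H₃) (G₄ + H₄) μ x
      = divL T U G₁ G₂ G₃ G₄ μ x + divL T U H₁ H₂ H₃ H₄ μ x := by
  simp only [divL, Pi.add_apply, R_add]
  rw [← Finset.sum_sub_distrib, ← Finset.sum_sub_distrib, ← Finset.sum_sub_distrib, ← Finset.sum_add_distrib]
  refine Finset.sum_congr rfl fun ν _ => ?_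
  split_ifs <;> abel

/-- `÷` is homogeneous (scalars of any commutative semiring acting on `𝔸`). [folklore] -/
theorem divL_smul {𝕂 : Type*} [CommSemiring 𝕂] [Algebra 𝕂 𝔸] (c : 𝕂) (G₁ G₂ G₃ G₄ : ι → ι → S → 𝔸) (μ : ι)
    (x : S) : divL T U (c • G₁) (c • G₂) (c • G₃) (c • G₄) μ x = c • divL T U G₁ G₂ G₃ G₄ μ x := by
  simp only [divL, Pi.smul_apply, R_smul, smul_sub, Finset.smul_sum, smul_ite, smul_zero]

/-- `D*` (first form of (3.9)) is additive — no antisymmetry needed. [folklore] -/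
theorem divP_add (F G : ι → ι → S → 𝔸) (μ : ι) (x : S) :
    divP T U (F + G) μ x = divP T U F μ x + divP T U G μ x := by
  rw [← divL_self, ← divL_self, ← divL_self]
  exact divL_add T U F F F F G G G G μ x

variable {𝕜 : Type*} [AddCommGroup 𝕜] {Φ : Type*} [FunLike Φ 𝔸 𝕜] [AddMonoidHomClass Φ 𝔸 𝕜]

omit [Fintype ι] [LinearOrder ι] [AddMonoidHomClass Φ 𝔸 𝕜] in
/-- REINDEXING A TRANSPORTED LETTER: `Σ_x τ(R(U_ν(x))f(x+e_ν)·G(x)) = Σ_y τ(f(y)·R(U_ν(y−e_ν))⁻¹G(y−e_ν))` — the bijection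
`T ν` and `trace_R_mul`; no commutation of shifts, no unitarity. [folklore] -/
theorem sum_transport_reindex [Fintype S] (τ : Φ) (hτ : ∀ a b : 𝔸, τ (a * b) = τ (b * a)) (ν : ι)
    (f G : S → 𝔸) :
    ∑ x, τ (R (U ν x) (f (T ν x)) * G x) = ∑ y, τ (f y * R (U ν ((T ν).symm y))⁻¹ (G ((T ν).symm y))) := by
  rw [← Equiv.sum_comp (T ν) (fun y => τ (f y * R (U ν ((T ν).symm y))⁻¹ (G ((T ν).symm y))))]
  simp only [Equiv.symm_apply_apply, trace_R_mul τ hτ]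

omit [LinearOrder ι] in
/-- `Σ_x Σ_μ Σ_ν [μ<ν] f_{μν}(x) = Σ_μ Σ_ν [μ<ν] Σ_x f_{μν}(x)`. [folklore] -/
theorem sum_sum_sum_ite [Fintype S] [LT ι] [DecidableRel (α := ι) (· < ·)] (f : ι → ι → S → 𝕜) :
    ∑ x, ∑ μ, ∑ ν, (if μ < ν then f μ ν x else 0) = ∑ μ, ∑ ν, if μ < ν then ∑ x, f μ ν x else 0 := by
  rw [Finset.sum_comm]
  refine Finset.sum_congr rfl fun μ _ => ?_
  rw [Finset.sum_comm]
  refine Finset.sum_congr rfl fun ν _ => ?_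
  by_cases h : μ < ν
  · simp only [if_pos h]
  · simp only [if_neg h, Finset.sum_const_zero]

omit [LinearOrder ι] in
/-- `Σ_x Σ_μ Σ_κ [κ<μ] f_{κμ}(x) = Σ_μ Σ_ν [μ<ν] Σ_x f_{μν}(x)` (rename the ordered pair). [folklore] -/
theorem sum_sum_sum_ite' [Fintype S] [LT ι] [DecidableRel (α := ι) (· < ·)] (f : ι → ι → S → 𝕜) :
    ∑ x, ∑ μ, ∑ κ, (if κ < μ then f κ μ x else 0) = ∑ μ, ∑ ν, if μ < ν then ∑ x, f μ ν x else 0 := by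
  rw [← sum_sum_sum_ite]
  exact Finset.sum_congr rfl fun x _ => Finset.sum_comm

variable [Fintype S]

/-- **LETTER ADJOINTNESS** (the mechanism of (3.9), one plaquette function per letter): pairing the four transported letters
of `B` around each positively oriented plaquette with `G₁, …, G₄` and summing over plaquettes is the bond pairing of `B` with
the letter divergence, `Σ_x Σ_{μ<ν} Σ_{k=1}^4 τ(B′_k(p_{μν}(x))·G_k(p_{μν}(x))) = Σ_x Σ_μ τ(B_μ(x)·(÷G)_μ(x))` — exact background
(arbitrary units), any ring, any additive tracial `τ`, any finite site set with bijective shifts.  With `G_k = F` for all `k`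
this is (3.9) (`B9Eq39Adjoint.sum_curl_mul`, since `Σ_k B′_k = (D_U B)(p)`). [folklore]
[cite: Balaban1985BackgroundPropagators, (3.9) p.392, (3.10) p.392] -/
theorem sum_letters_mul (τ : Φ) (hτ : ∀ a b : 𝔸, τ (a * b) = τ (b * a)) (B : ι → S → 𝔸)
    (G₁ G₂ G₃ G₄ : ι → ι → S → 𝔸) :
    ∑ x, ∑ μ, ∑ ν, (if μ < ν then
        τ (-(R (U ν x) (B μ (T ν x))) * G₁ μ ν x) + τ (-(B ν x) * G₂ μ ν x)
          + τ (B μ x * G₃ μ ν x) + τ (R (U μ x) (B ν (T μ x)) * G₄ μ ν x) else 0)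
      = ∑ x, ∑ μ, τ (B μ x * divL T U G₁ G₂ G₃ G₄ μ x) := by
  rw [sum_sum_sum_ite]
  -- right side: expand `÷G`, push `B_μ(x)` and `τ` inside, bring the site sum innermost, rename the `ν < μ` half
  have e : ∀ x μ, τ (B μ x * divL T U G₁ G₂ G₃ G₄ μ x)
      = (∑ ν, if ν < μ then
            τ (B μ x * R (U ν ((T ν).symm x))⁻¹ (G₄ ν μ ((T ν).symm x))) - τ (B μ x * G₂ ν μ x) else 0)
        - ∑ ν, if μ < ν then
            τ (B μ x * R (U ν ((T ν).symm x))⁻¹ (G₁ μ ν ((T ν).symm x))) - τ (B μ x * G₃ μ ν x) else 0 := by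
    intro x μ
    simp only [divL, mul_sub, map_sub, Finset.mul_sum, map_sum, mul_ite, mul_zero, apply_ite τ, map_zero]
  simp only [e, Finset.sum_sub_distrib]
  rw [sum_sum_sum_ite' (f := fun ν μ x =>
        τ (B μ x * R (U ν ((T ν).symm x))⁻¹ (G₄ ν μ ((T ν).symm x))) - τ (B μ x * G₂ ν μ x)),
    sum_sum_sum_ite (f := fun μ ν x =>
        τ (B μ x * R (U ν ((T ν).symm x))⁻¹ (G₁ μ ν ((T ν).symm x))) - τ (B μ x * G₃ μ ν x)),
    ← Finset.sum_sub_distrib]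
  refine Finset.sum_congr rfl fun μ _ => ?_
  rw [← Finset.sum_sub_distrib]
  refine Finset.sum_congr rfl fun ν _ => ?_
  split_ifs with h
  · simp only [Finset.sum_add_distrib, Finset.sum_sub_distrib, neg_mul, map_neg, Finset.sum_neg_distrib]
    rw [sum_transport_reindex T U τ hτ ν (B μ) (G₁ μ ν), sum_transport_reindex T U τ hτ μ (B ν) (G₄ μ ν)]
    abel
  · simp

/-- JORDAN SYMMETRY UNDER A TRACE: `τ(X·(YZ + ZY)) = τ(Y·(XZ + ZX))`. [folklore] -/
theorem trace_jordan_symm (τ : Φ) (hτ : ∀ a b : 𝔸, τ (a * b) = τ (b * a)) (X Y Z : 𝔸) :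
    τ (X * (Y * Z + Z * Y)) = τ (Y * (X * Z + Z * X)) := by
  have hc : ∀ u v : 𝔸, τ (u * (Z * v)) = τ (v * (u * Z)) := fun u v => by rw [← mul_assoc, hτ]
  simp only [mul_add, map_add, hc]
  abel

/-- THE FOUR-LETTER COMMUTATOR PAIRING IS SYMMETRIC: with the signed partner sums `S_k(a) = Σ_{j<k}a_j − Σ_{j>k}a_j` of four
letters, `Σ_k τ(b_k·(Y·S_k(a) − S_k(a)·Y)) = Σ_k τ(a_k·(Y·S_k(b) − S_k(b)·Y))` for any additive tracial `τ` — the polarisation of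
`τ(Σ_{j<k}[a_j,a_k]·Y)` is symmetric. [folklore] -/
theorem four_letter_symm (τ : Φ) (hτ : ∀ a b : 𝔸, τ (a * b) = τ (b * a)) (a₁ a₂ a₃ a₄ b₁ b₂ b₃ b₄ Y : 𝔸) :
    τ (b₁ * (Y * -(a₂ + a₃ + a₄) - -(a₂ + a₃ + a₄) * Y)) + τ (b₂ * (Y * (a₁ - (a₃ + a₄)) - (a₁ - (a₃ + a₄)) * Y))
        + τ (b₃ * (Y * (a₁ + a₂ - a₄) - (a₁ + a₂ - a₄) * Y)) + τ (b₄ * (Y * (a₁ + a₂ + a₃) - (a₁ + a₂ + a₃) * Y))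
      = τ (a₁ * (Y * -(b₂ + b₃ + b₄) - -(b₂ + b₃ + b₄) * Y)) + τ (a₂ * (Y * (b₁ - (b₃ + b₄)) - (b₁ - (b₃ + b₄)) * Y))
        + τ (a₃ * (Y * (b₁ + b₂ - b₄) - (b₁ + b₂ - b₄) * Y)) + τ (a₄ * (Y * (b₁ + b₂ + b₃) - (b₁ + b₂ + b₃) * Y)) := by
  have hc : ∀ u v : 𝔸, τ (u * (Y * v)) = τ (v * (u * Y)) := fun u v => by rw [← mul_assoc, hτ]
  simp only [mul_add, mul_sub, mul_neg, add_mul, sub_mul, neg_mul, map_add, map_sub, map_neg, hc]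
  abel

end LetterDiv

/-! ## §2  `Δ′` and `Δ = D*D_U + Δ′` as OPERATORS on bond fields (ℂ-algebra; the printed `η`-weights) -/

section Operator

variable {𝔸 : Type*} [Ring 𝔸] [Algebra ℂ 𝔸] {S : Type*} {ι : Type*}
variable (T : ι → Equiv.Perm S) (U : ι → S → 𝔸ˣ)

/-- `z(p) = η⁻²(Re U(∂p) − 1)` for `p = p_{μν}(x)`, with the complexified `Re` of p. 391 (`B9Eq37Insertion.reC`) — the weight
of the first term of `⟨A,Δ′A⟩` in (3.10). [folklore] [cite: Balaban1985BackgroundPropagators, (3.10) p.392, p.391] -/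
def zP (η : ℝ) (μ ν : ι) (x : S) : 𝔸 := (((η : ℂ)⁻¹) ^ 2) • (reC (plaqU T U μ ν x) - 1)

/-- `y(p) = η⁻² Im U(∂p)` for `p = p_{μν}(x)`, with the complexified `Im` of p. 391 (`B9Eq37Insertion.imC`) — the weight of
the commutator term of `⟨A,Δ′A⟩` in (3.10) (and of `J` in (3.11)). [folklore]
[cite: Balaban1985BackgroundPropagators, (3.10) p.392, (3.11) p.392] -/
def yP (η : ℝ) (μ ν : ι) (x : S) : 𝔸 := (((η : ℂ)⁻¹) ^ 2) • imC (plaqU T U μ ν x)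

/-- THE JORDAN-SYMMETRISED FIRST TERM as a plaquette function: `F^J_A(p) = ½((D¹_U A)(p)·z(p) + z(p)·(D¹_U A)(p))`; under the
trace, `τ((D¹_U A)(p)·F^J_A(p)) = τ(((D¹_U A)(p))²·z(p))` is the first term of (3.10) (`sum_mul_divP_jordanF`). [folklore]
[cite: Balaban1985BackgroundPropagators, (3.10) p.392] -/
def jordanF (η : ℝ) (A : ι → S → 𝔸) (μ ν : ι) (x : S) : 𝔸 :=
  (2 : ℂ)⁻¹ • (curl T U A μ ν x * zP T U η μ ν x + zP T U η μ ν x * curl T U A μ ν x)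

/-- SIGNED PARTNER SUM of the first letter: `S₁ = −(A′₂ + A′₃ + A′₄)` (`S_k = Σ_{j<k}A′_j − Σ_{j>k}A′_j`, the letters `A′_j` in
the contour order of `lettersA`). [folklore] -/
def sgnSum₁ (A : ι → S → 𝔸) (μ ν : ι) (x : S) : 𝔸 := -(-(A ν x) + A μ x + R (U μ x) (A ν (T μ x)))

/-- `S₂ = A′₁ − (A′₃ + A′₄)`. [folklore] -/
def sgnSum₂ (A : ι → S → 𝔸) (μ ν : ι) (x : S) : 𝔸 :=
  -(R (U ν x) (A μ (T ν x))) - (A μ x + R (U μ x) (A ν (T μ x)))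

/-- `S₃ = A′₁ + A′₂ − A′₄`. [folklore] -/
def sgnSum₃ (A : ι → S → 𝔸) (μ ν : ι) (x : S) : 𝔸 :=
  -(R (U ν x) (A μ (T ν x))) + -(A ν x) - R (U μ x) (A ν (T μ x))

/-- `S₄ = A′₁ + A′₂ + A′₃`. [folklore] -/
def sgnSum₄ (A : ι → S → 𝔸) (μ ν : ι) (x : S) : 𝔸 := -(R (U ν x) (A μ (T ν x))) + -(A ν x) + A μ x

/-- COMMUTATOR LETTER FUNCTION, slot 1: `G₁(p) = (i/2)[y(p), S₁(p)]` — the coefficient of `B′₁(p)` in the polarisation of the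
commutator term `τ(i Σ_{j<k}[A′_j,A′_k]·y(p))` of (3.10). [folklore] [cite: Balaban1985BackgroundPropagators, (3.10) p.392] -/
def commG₁ (η : ℝ) (A : ι → S → 𝔸) (μ ν : ι) (x : S) : 𝔸 :=
  (I / 2) • (yP T U η μ ν x * sgnSum₁ T U A μ ν x - sgnSum₁ T U A μ ν x * yP T U η μ ν x)

/-- Slot 2: `G₂(p) = (i/2)[y(p), S₂(p)]`. [folklore] -/
def commG₂ (η : ℝ) (A : ι → S → 𝔸) (μ ν : ι) (x : S) : 𝔸 :=
  (I / 2) • (yP T U η μ ν x * sgnSum₂ T U A μ ν x - sgnSum₂ T U A μ ν x * yP T U η μ ν x)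

/-- Slot 3: `G₃(p) = (i/2)[y(p), S₃(p)]`. [folklore] -/
def commG₃ (η : ℝ) (A : ι → S → 𝔸) (μ ν : ι) (x : S) : 𝔸 :=
  (I / 2) • (yP T U η μ ν x * sgnSum₃ T U A μ ν x - sgnSum₃ T U A μ ν x * yP T U η μ ν x)

/-- Slot 4: `G₄(p) = (i/2)[y(p), S₄(p)]`. [folklore] -/
def commG₄ (η : ℝ) (A : ι → S → 𝔸) (μ ν : ι) (x : S) : 𝔸 :=
  (I / 2) • (yP T U η μ ν x * sgnSum₄ T U A μ ν x - sgnSum₄ T U A μ ν x * yP T U η μ ν x)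

variable [Fintype ι] [LinearOrder ι]

/-- **THE OPERATOR `Δ′`** of (3.10) on bond fields: `(Δ′A)(b) = (D*F^J_A)(b) + (÷(G₁,G₂,G₃,G₄)_A)(b)` — the plaquette adjoint
(3.9) of the Jordan-symmetrised first term plus the letter divergence of the commutator letter functions.  Its form
`⟨A, Δ′A⟩` is the printed `⟨A,Δ′A⟩` (`bondPair_deltaPrimeOp_self`) and it is symmetric (`bondPair_deltaPrimeOp_symm`).
[folklore] [cite: Balaban1985BackgroundPropagators, (3.10) p.392] -/
def deltaPrimeOp (η : ℝ) (A : ι → S → 𝔸) (μ : ι) (x : S) : 𝔸 :=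
  divP T U (jordanF T U η A) μ x
    + divL T U (commG₁ T U η A) (commG₂ T U η A) (commG₃ T U η A) (commG₄ T U η A) μ x

/-- **THE OPERATOR `Δ = Δ^η(U) = D^{η*}D^η_U + Δ′`** of (3.10) on bond fields («the basic operator generalizing the operator ∂*∂
in the Abelian case»). [folklore] [cite: Balaban1985BackgroundPropagators, (3.10) p.392] -/
def deltaOp (η : ℝ) (A : ι → S → 𝔸) (μ : ι) (x : S) : 𝔸 :=
  divPη T U η (curlη T U η A) μ x + deltaPrimeOp T U η A μ x

/-! ### Linearity in the field -/

omit [Algebra ℂ 𝔸] [Fintype ι] [LinearOrder ι] in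
/-- The curl is additive. [folklore] -/
theorem curl_add (A B : ι → S → 𝔸) (μ ν : ι) (x : S) :
    curl T U (A + B) μ ν x = curl T U A μ ν x + curl T U B μ ν x := by
  simp only [curl, covD, Pi.add_apply, R_add]
  abel

omit [Fintype ι] [LinearOrder ι] in
/-- `D^η_U` is additive. [folklore] -/
theorem curlη_add (η : ℝ) (A B : ι → S → 𝔸) : curlη T U η (A + B) = curlη T U η A + curlη T U η B := by
  funext μ ν x
  simp only [curlη, Pi.add_apply, curl_add, smul_add]

omit [Fintype ι] [LinearOrder ι] in
/-- `D^η_U` is homogeneous. [folklore] -/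
theorem curlη_smul (η : ℝ) (c : ℂ) (A : ι → S → 𝔸) : curlη T U η (c • A) = c • curlη T U η A := by
  funext μ ν x
  simp only [curlη, Pi.smul_apply, curl_smul]
  rw [smul_comm]

/-- `D^{η*}` is additive. [folklore] -/
theorem divPη_add (η : ℝ) (F G : ι → ι → S → 𝔸) (μ : ι) (x : S) :
    divPη T U η (F + G) μ x = divPη T U η F μ x + divPη T U η G μ x := by
  simp only [divPη, divP_add, smul_add]

/-- `D^{η*}` is homogeneous. [folklore] -/
theorem divPη_smul (η : ℝ) (c : ℂ) (F : ι → ι → S → 𝔸) (μ : ι) (x : S) :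
    divPη T U η (c • F) μ x = c • divPη T U η F μ x := by
  simp only [divPη, divP_smul]
  rw [smul_comm]

omit [Fintype ι] [LinearOrder ι] in
/-- `F^J` is additive in `A`. [folklore] -/
theorem jordanF_add (η : ℝ) (A B : ι → S → 𝔸) :
    jordanF T U η (A + B) = jordanF T U η A + jordanF T U η B := by
  funext μ ν x
  simp only [jordanF, Pi.add_apply, curl_add, add_mul, mul_add, ← smul_add]
  congr 1
  abel

omit [Fintype ι] [LinearOrder ι] in
/-- `F^J` is homogeneous in `A`. [folklore] -/
theorem jordanF_smul (η : ℝ) (c : ℂ) (A : ι → S → 𝔸) :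
    jordanF T U η (c • A) = c • jordanF T U η A := by
  funext μ ν x
  simp only [jordanF, Pi.smul_apply, curl_smul, smul_mul_assoc, mul_smul_comm, ← smul_add]
  rw [smul_comm]

omit [Algebra ℂ 𝔸] [Fintype ι] [LinearOrder ι] in
/-- The signed partner sums are additive … [folklore] -/
theorem sgnSum_add (A B : ι → S → 𝔸) (μ ν : ι) (x : S) :
    sgnSum₁ T U (A + B) μ ν x = sgnSum₁ T U A μ ν x + sgnSum₁ T U B μ ν x
      ∧ sgnSum₂ T U (A + B) μ ν x = sgnSum₂ T U A μ ν x + sgnSum₂ T U B μ ν x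
      ∧ sgnSum₃ T U (A + B) μ ν x = sgnSum₃ T U A μ ν x + sgnSum₃ T U B μ ν x
      ∧ sgnSum₄ T U (A + B) μ ν x = sgnSum₄ T U A μ ν x + sgnSum₄ T U B μ ν x := by
  simp only [sgnSum₁, sgnSum₂, sgnSum₃, sgnSum₄, Pi.add_apply, R_add]
  refine ⟨?_, ?_, ?_, ?_⟩ <;> abel

omit [Fintype ι] [LinearOrder ι] in
/-- … and homogeneous. [folklore] -/
theorem sgnSum_smul (c : ℂ) (A : ι → S → 𝔸) (μ ν : ι) (x : S) :
    sgnSum₁ T U (c • A) μ ν x = c • sgnSum₁ T U A μ ν x ∧ sgnSum₂ T U (c • A) μ ν x = c • sgnSum₂ T U A μ ν x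
      ∧ sgnSum₃ T U (c • A) μ ν x = c • sgnSum₃ T U A μ ν x ∧ sgnSum₄ T U (c • A) μ ν x = c • sgnSum₄ T U A μ ν x := by
  refine ⟨?_, ?_, ?_, ?_⟩ <;>
    simp only [sgnSum₁, sgnSum₂, sgnSum₃, sgnSum₄, Pi.smul_apply, R_smul, smul_add, smul_sub, smul_neg]

omit [Fintype ι] [LinearOrder ι] in
/-- The commutator letter functions are additive in `A` … [folklore] -/
theorem commG_add (η : ℝ) (A B : ι → S → 𝔸) :
    commG₁ T U η (A + B) = commG₁ T U η A + commG₁ T U η B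
      ∧ commG₂ T U η (A + B) = commG₂ T U η A + commG₂ T U η B
      ∧ commG₃ T U η (A + B) = commG₃ T U η A + commG₃ T U η B
      ∧ commG₄ T U η (A + B) = commG₄ T U η A + commG₄ T U η B := by
  refine ⟨?_, ?_, ?_, ?_⟩
  all_goals
    funext μ ν x
    obtain ⟨h₁, h₂, h₃, h₄⟩ := sgnSum_add T U A B μ ν x
    simp only [commG₁, commG₂, commG₃, commG₄, Pi.add_apply, h₁, h₂, h₃, h₄, mul_add, add_mul, ← smul_add]
    congr 1
    abel

omit [Fintype ι] [LinearOrder ι] in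
/-- … and homogeneous. [folklore] -/
theorem commG_smul (η : ℝ) (c : ℂ) (A : ι → S → 𝔸) :
    commG₁ T U η (c • A) = c • commG₁ T U η A ∧ commG₂ T U η (c • A) = c • commG₂ T U η A
      ∧ commG₃ T U η (c • A) = c • commG₃ T U η A ∧ commG₄ T U η (c • A) = c • commG₄ T U η A := by
  refine ⟨?_, ?_, ?_, ?_⟩
  all_goals
    funext μ ν x
    obtain ⟨h₁, h₂, h₃, h₄⟩ := sgnSum_smul T U c A μ ν x
    simp only [commG₁, commG₂, commG₃, commG₄, Pi.smul_apply, h₁, h₂, h₃, h₄, mul_smul_comm, smul_mul_assoc,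
      ← smul_sub]
    rw [smul_comm]

/-- **`Δ′` IS ADDITIVE.** [folklore] -/
theorem deltaPrimeOp_add (η : ℝ) (A B : ι → S → 𝔸) (μ : ι) (x : S) :
    deltaPrimeOp T U η (A + B) μ x = deltaPrimeOp T U η A μ x + deltaPrimeOp T U η B μ x := by
  obtain ⟨h₁, h₂, h₃, h₄⟩ := commG_add T U η A B
  rw [deltaPrimeOp, jordanF_add, divP_add, h₁, h₂, h₃, h₄, divL_add, deltaPrimeOp, deltaPrimeOp]
  abel

/-- **`Δ′` IS HOMOGENEOUS.** [folklore] -/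
theorem deltaPrimeOp_smul (η : ℝ) (c : ℂ) (A : ι → S → 𝔸) (μ : ι) (x : S) :
    deltaPrimeOp T U η (c • A) μ x = c • deltaPrimeOp T U η A μ x := by
  obtain ⟨h₁, h₂, h₃, h₄⟩ := commG_smul T U η c A
  rw [deltaPrimeOp, jordanF_smul, divP_smul, h₁, h₂, h₃, h₄, divL_smul, deltaPrimeOp, smul_add]

/-- **`Δ` IS ADDITIVE.** [folklore] -/
theorem deltaOp_add (η : ℝ) (A B : ι → S → 𝔸) (μ : ι) (x : S) :
    deltaOp T U η (A + B) μ x = deltaOp T U η A μ x + deltaOp T U η B μ x := by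
  rw [deltaOp, curlη_add, divPη_add, deltaPrimeOp_add, deltaOp, deltaOp]
  abel

/-- **`Δ` IS HOMOGENEOUS.** [folklore] -/
theorem deltaOp_smul (η : ℝ) (c : ℂ) (A : ι → S → 𝔸) (μ : ι) (x : S) :
    deltaOp T U η (c • A) μ x = c • deltaOp T U η A μ x := by
  rw [deltaOp, curlη_smul, divPη_smul, deltaPrimeOp_smul, deltaOp, smul_add]

/-- `Δ` on bond fields, as a function: additive. [folklore] -/
theorem deltaOp_add_fun (η : ℝ) (A B : ι → S → 𝔸) : deltaOp T U η (A + B) = deltaOp T U η A + deltaOp T U η B := by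
  funext μ x
  exact deltaOp_add T U η A B μ x

/-! ### The quadratic form of the operator and its symmetry -/

variable [Fintype S]

omit [LinearOrder ι] in
/-- The bond pairing (3.11) is additive on the left … [folklore] -/
theorem bondPair_add_left (η : ℝ) (d : ℕ) (τ : 𝔸 →ₗ[ℂ] ℂ) (A B E : ι → S → 𝔸) :
    bondPair η d τ (A + B) E = bondPair η d τ A E + bondPair η d τ B E := by
  simp only [bondPair, Pi.add_apply, add_mul, map_add, Finset.sum_add_distrib, mul_add]

omit [LinearOrder ι] in
/-- … and on the right. [folklore] -/
theorem bondPair_add_right (η : ℝ) (d : ℕ) (τ : 𝔸 →ₗ[ℂ] ℂ) (A E F : ι → S → 𝔸) :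
    bondPair η d τ A (E + F) = bondPair η d τ A E + bondPair η d τ A F := by
  simp only [bondPair, Pi.add_apply, mul_add, map_add, Finset.sum_add_distrib]

/-- THE JORDAN PART PAIRS TO THE FIRST TERM OF (3.10): `Σ_b τ(A(b)·(D*F^J_A)(b)) = Σ_{p⊂T} τ(((D¹_U A)(p))²·z(p))` — (3.9)
(`B9Eq39Adjoint.sum_posPlaq_curl_mul`) and `τ(X·½(XZ + ZX)) = τ(X²Z)`. [folklore]
[cite: Balaban1985BackgroundPropagators, (3.9) p.392, (3.10) p.392] -/
theorem sum_mul_divP_jordanF (τ : 𝔸 →ₗ[ℂ] ℂ) (hτ : ∀ a b : 𝔸, τ (a * b) = τ (b * a)) (η : ℝ) (A : ι → S → 𝔸) :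
    ∑ x, ∑ μ, τ (A μ x * divP T U (jordanF T U η A) μ x)
      = ∑ q ∈ posPlaq S ι, τ (curl T U A q.2.1 q.2.2 q.1 * curl T U A q.2.1 q.2.2 q.1 * zP T U η q.2.1 q.2.2 q.1) := by
  rw [← sum_posPlaq_curl_mul T U τ hτ A (jordanF T U η A)]
  refine Finset.sum_congr rfl fun q _ => ?_
  simp only [jordanF, mul_smul_comm, mul_add, map_smul, map_add, smul_eq_mul]
  generalize curl T U A q.2.1 q.2.2 q.1 = c
  generalize zP T U η q.2.1 q.2.2 q.1 = z
  rw [show τ (c * (z * c)) = τ (c * c * z) by rw [← mul_assoc, hτ, ← mul_assoc], ← mul_assoc]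
  ring

/-- THE JORDAN PART IS SYMMETRIC: `Σ_b τ(B(b)·(D*F^J_A)(b)) = Σ_b τ(A(b)·(D*F^J_B)(b))`. [folklore] -/
theorem sum_mul_divP_jordanF_symm (τ : 𝔸 →ₗ[ℂ] ℂ) (hτ : ∀ a b : 𝔸, τ (a * b) = τ (b * a)) (η : ℝ)
    (A B : ι → S → 𝔸) :
    ∑ x, ∑ μ, τ (B μ x * divP T U (jordanF T U η A) μ x) = ∑ x, ∑ μ, τ (A μ x * divP T U (jordanF T U η B) μ x) := by
  rw [← sum_curl_mul T U τ hτ B, ← sum_curl_mul T U τ hτ A]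
  refine Finset.sum_congr rfl fun x _ => Finset.sum_congr rfl fun μ _ => Finset.sum_congr rfl fun ν _ => ?_
  split_ifs with h
  · simp only [jordanF, mul_smul_comm, map_smul]
    rw [trace_jordan_symm τ hτ]
  · rfl

/-- THE COMMUTATOR PART IS SYMMETRIC: `Σ_b τ(B(b)·(÷G_A)(b)) = Σ_b τ(A(b)·(÷G_B)(b))` — letter adjointness both ways and
`four_letter_symm` plaquette by plaquette. [folklore] -/
theorem sum_mul_divL_commG_symm (τ : 𝔸 →ₗ[ℂ] ℂ) (hτ : ∀ a b : 𝔸, τ (a * b) = τ (b * a)) (η : ℝ)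
    (A B : ι → S → 𝔸) :
    ∑ x, ∑ μ, τ (B μ x * divL T U (commG₁ T U η A) (commG₂ T U η A) (commG₃ T U η A) (commG₄ T U η A) μ x)
      = ∑ x, ∑ μ, τ (A μ x * divL T U (commG₁ T U η B) (commG₂ T U η B) (commG₃ T U η B) (commG₄ T U η B) μ x) := by
  rw [← sum_letters_mul T U τ hτ B, ← sum_letters_mul T U τ hτ A]
  refine Finset.sum_congr rfl fun x _ => Finset.sum_congr rfl fun μ _ => Finset.sum_congr rfl fun ν _ => ?_
  split_ifs with h
  · simp only [commG₁, commG₂, commG₃, commG₄, sgnSum₁, sgnSum₂, sgnSum₃, sgnSum₄, mul_smul_comm, map_smul]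
    rw [← smul_add, ← smul_add, ← smul_add, ← smul_add, ← smul_add, ← smul_add, four_letter_symm τ hτ]
  · rfl

/-- THE `D*D` PART IS SYMMETRIC: `⟨B, D^{η*}D^η_U A⟩ = ⟨A, D^{η*}D^η_U B⟩`. [folklore] -/
theorem bondPair_divPη_curlη_symm (τ : 𝔸 →ₗ[ℂ] ℂ) (hτ : ∀ a b : 𝔸, τ (a * b) = τ (b * a)) (η : ℝ) (d : ℕ)
    (A B : ι → S → 𝔸) :
    bondPair η d τ B (divPη T U η (curlη T U η A)) = bondPair η d τ A (divPη T U η (curlη T U η B)) := by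
  rw [bondPair_divPη T U τ hτ, bondPair_divPη T U τ hτ]
  congr 1
  exact Finset.sum_congr rfl fun q _ => hτ _ _

/-- **`Δ′` IS SYMMETRIC FOR THE PAIRING (3.11)**: `⟨B, Δ′A⟩ = ⟨A, Δ′B⟩` — exact background, any tracial ℂ-linear `τ`.
[folklore] [cite: Balaban1985BackgroundPropagators, (3.10) p.392, (3.11) p.392] -/
theorem bondPair_deltaPrimeOp_symm (τ : 𝔸 →ₗ[ℂ] ℂ) (hτ : ∀ a b : 𝔸, τ (a * b) = τ (b * a)) (η : ℝ) (d : ℕ)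
    (A B : ι → S → 𝔸) :
    bondPair η d τ B (deltaPrimeOp T U η A) = bondPair η d τ A (deltaPrimeOp T U η B) := by
  simp only [bondPair, deltaPrimeOp, mul_add, map_add, Finset.sum_add_distrib]
  rw [sum_mul_divP_jordanF_symm T U τ hτ η A B, sum_mul_divL_commG_symm T U τ hτ η A B]

/-- **`Δ` IS SYMMETRIC FOR THE PAIRING (3.11)**: `⟨B, ΔA⟩ = ⟨A, ΔB⟩` — the algebraic content of «it is a hermitian operator»
(with §4: `Δ` commutes with `*`, and `⟨A, ΔA⟩` is real). [folklore] [cite: Balaban1985BackgroundPropagators, (3.10) p.392] -/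
theorem bondPair_deltaOp_symm (τ : 𝔸 →ₗ[ℂ] ℂ) (hτ : ∀ a b : 𝔸, τ (a * b) = τ (b * a)) (η : ℝ) (d : ℕ)
    (A B : ι → S → 𝔸) :
    bondPair η d τ B (deltaOp T U η A) = bondPair η d τ A (deltaOp T U η B) := by
  have e : ∀ C D : ι → S → 𝔸, bondPair η d τ C (deltaOp T U η D)
      = bondPair η d τ C (divPη T U η (curlη T U η D)) + bondPair η d τ C (deltaPrimeOp T U η D) := by
    intro C D
    simp only [bondPair, deltaOp, mul_add, map_add, Finset.sum_add_distrib]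
  rw [e, e, bondPair_divPη_curlη_symm T U τ hτ, bondPair_deltaPrimeOp_symm T U τ hτ]

end Operator

/-! ## §3  The form of the operator IS the printed quadratic form (3.10) -/

section QuadraticForm

variable {𝔸 : Type*} [NormedRing 𝔸] [NormedAlgebra ℂ 𝔸]
variable {S : Type*} [Fintype S] {ι : Type*} [Fintype ι] [LinearOrder ι]
variable (T : ι → Equiv.Perm S) (U : ι → S → 𝔸ˣ)

omit [NormedAlgebra ℂ 𝔸] in
/-- THE FOUR-LETTER TRACE IDENTITY behind the commutator term: with `S_k = Σ_{j<k}a_j − Σ_{j>k}a_j`,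
`Σ_k τ(a_k·(Y S_k − S_k Y)) = 2·τ((Σ_{j<k}[a_j,a_k])·Y)` (`commSum [a₁,a₂,a₃,a₄] = Σ_{j<k}[a_j,a_k]`, `commSum_four`) — any ring,
any additive tracial `τ`. [folklore] -/
theorem four_letter_comm_trace {𝕜 : Type*} [AddCommGroup 𝕜] {Φ : Type*} [FunLike Φ 𝔸 𝕜] [AddMonoidHomClass Φ 𝔸 𝕜]
    (τ : Φ) (hτ : ∀ a b : 𝔸, τ (a * b) = τ (b * a)) (a₁ a₂ a₃ a₄ Y : 𝔸) :
    τ (a₁ * (Y * -(a₂ + a₃ + a₄) - -(a₂ + a₃ + a₄) * Y)) + τ (a₂ * (Y * (a₁ - (a₃ + a₄)) - (a₁ - (a₃ + a₄)) * Y))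
        + τ (a₃ * (Y * (a₁ + a₂ - a₄) - (a₁ + a₂ - a₄) * Y)) + τ (a₄ * (Y * (a₁ + a₂ + a₃) - (a₁ + a₂ + a₃) * Y))
      = τ (commSum [a₁, a₂, a₃, a₄] * Y) + τ (commSum [a₁, a₂, a₃, a₄] * Y) := by
  have hc : ∀ u v : 𝔸, τ (u * (Y * v)) = τ (v * (u * Y)) := fun u v => by rw [← mul_assoc, hτ]
  rw [commSum_four]
  simp only [mul_add, mul_sub, mul_neg, add_mul, sub_mul, neg_mul, map_add, map_sub, map_neg, mul_assoc, hc]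
  abel

/-- THE COMMUTATOR PART PAIRS TO THE SECOND TERM OF (3.10): `Σ_b τ(A(b)·(÷G_A)(b)) = Σ_{p⊂T} τ(i·Σ_{j<k}[A′_j,A′_k]·y(p))` —
letter adjointness (`sum_letters_mul`) and `four_letter_comm_trace`. [folklore]
[cite: Balaban1985BackgroundPropagators, (3.10) p.392] -/
theorem sum_mul_divL_commG_self (τ : 𝔸 →ₗ[ℂ] ℂ) (hτ : ∀ a b : 𝔸, τ (a * b) = τ (b * a)) (η : ℝ)
    (A : ι → S → 𝔸) :
    ∑ x, ∑ μ, τ (A μ x * divL T U (commG₁ T U η A) (commG₂ T U η A) (commG₃ T U η A) (commG₄ T U η A) μ x)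
      = ∑ q ∈ posPlaq S ι, τ ((I • commSum (lettersA T U A q.2.1 q.2.2 q.1)) * yP T U η q.2.1 q.2.2 q.1) := by
  rw [sum_posPlaq (fun x μ ν => τ ((I • commSum (lettersA T U A μ ν x)) * yP T U η μ ν x)),
    ← sum_letters_mul T U τ hτ A]
  refine Finset.sum_congr rfl fun x _ => Finset.sum_congr rfl fun μ _ => Finset.sum_congr rfl fun ν _ => ?_
  split_ifs with h
  · simp only [commG₁, commG₂, commG₃, commG₄, sgnSum₁, sgnSum₂, sgnSum₃, sgnSum₄, mul_smul_comm, map_smul,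
      smul_eq_mul, lettersA]
    rw [← mul_add, ← mul_add, ← mul_add, four_letter_comm_trace τ hτ, smul_mul_assoc, map_smul, smul_eq_mul]
    ring
  · rfl

/-- **THE FORM OF `Δ′` IS THE PRINTED `⟨A,Δ′A⟩` OF (3.10)**: `⟨A, Δ′A⟩ = Σ_{p⊂T_η} η^d[τ(((D¹_U A)(p))² η⁻²(Re U(∂p) − 1))
+ τ(i Σ_{b₁≺b₂}[A′(b₁),A′(b₂)] η⁻² Im U(∂p))]` (`B9Eq39Adjoint.deltaPrime`), exact background. [folklore]
[cite: Balaban1985BackgroundPropagators, (3.10) p.392] -/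
theorem bondPair_deltaPrimeOp_self (τ : 𝔸 →ₗ[ℂ] ℂ) (hτ : ∀ a b : 𝔸, τ (a * b) = τ (b * a)) (η : ℝ) (d : ℕ)
    (A : ι → S → 𝔸) :
    bondPair η d τ A (deltaPrimeOp T U η A) = deltaPrime T U η d τ A := by
  simp only [bondPair, deltaPrimeOp, mul_add, map_add, Finset.sum_add_distrib]
  rw [sum_mul_divP_jordanF T U τ hτ η A, sum_mul_divL_commG_self T U τ hτ η A, ← mul_add,
    ← Finset.sum_add_distrib]
  rfl

/-- **THE FORM OF `Δ` IS THE PRINTED `⟨A,ΔA⟩ = ⟨A,D*DA⟩ + ⟨A,Δ′A⟩` OF (3.10)** (`B9Eq39Adjoint.hessPair`, the quadratic term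
of (3.12)). [folklore] [cite: Balaban1985BackgroundPropagators, (3.10) p.392, (3.12) p.392] -/
theorem bondPair_deltaOp_self (τ : 𝔸 →ₗ[ℂ] ℂ) (hτ : ∀ a b : 𝔸, τ (a * b) = τ (b * a)) (η : ℝ) (d : ℕ)
    (A : ι → S → 𝔸) :
    bondPair η d τ A (deltaOp T U η A) = hessPair T U η d τ A := by
  rw [hessPair, ← bondPair_deltaPrimeOp_self T U τ hτ]
  simp only [bondPair, deltaOp, mul_add, map_add, Finset.sum_add_distrib]

/-- **POLARISATION**: the printed quadratic form determines the symmetric operator — `⟨A, ΔB⟩ = ½(Q(A+B) − Q(A) − Q(B))`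
with `Q = hessPair` = `⟨·,Δ·⟩` of (3.10): `Q(A + B) = Q(A) + Q(B) + 2⟨A, ΔB⟩`. [folklore]
[cite: Balaban1985BackgroundPropagators, (3.10) p.392] -/
theorem hessPair_add (τ : 𝔸 →ₗ[ℂ] ℂ) (hτ : ∀ a b : 𝔸, τ (a * b) = τ (b * a)) (η : ℝ) (d : ℕ)
    (A B : ι → S → 𝔸) :
    hessPair T U η d τ (A + B)
      = hessPair T U η d τ A + hessPair T U η d τ B + 2 * bondPair η d τ A (deltaOp T U η B) := by
  rw [← bondPair_deltaOp_self T U τ hτ, ← bondPair_deltaOp_self T U τ hτ, ← bondPair_deltaOp_self T U τ hτ,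
    deltaOp_add_fun, bondPair_add_left, bondPair_add_right, bondPair_add_right,
    bondPair_deltaOp_symm T U τ hτ η d A B]
  ring

/-- The same for `Δ′` alone: `⟨A+B, Δ′(A+B)⟩ = ⟨A,Δ′A⟩ + ⟨B,Δ′B⟩ + 2⟨A, Δ′B⟩`. [folklore] -/
theorem deltaPrime_add (τ : 𝔸 →ₗ[ℂ] ℂ) (hτ : ∀ a b : 𝔸, τ (a * b) = τ (b * a)) (η : ℝ) (d : ℕ)
    (A B : ι → S → 𝔸) :
    deltaPrime T U η d τ (A + B)
      = deltaPrime T U η d τ A + deltaPrime T U η d τ B + 2 * bondPair η d τ A (deltaPrimeOp T U η B) := by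
  have e : deltaPrimeOp T U η (A + B) = deltaPrimeOp T U η A + deltaPrimeOp T U η B := by
    funext μ x
    exact deltaPrimeOp_add T U η A B μ x
  rw [← bondPair_deltaPrimeOp_self T U τ hτ, ← bondPair_deltaPrimeOp_self T U τ hτ,
    ← bondPair_deltaPrimeOp_self T U τ hτ, e, bondPair_add_left, bondPair_add_right, bondPair_add_right,
    bondPair_deltaPrimeOp_symm T U τ hτ η d A B]
  ring

end QuadraticForm

/-! ## §4  HERMITICITY on the unitary group: `U(b)⁻¹ = U(b)*` -/

section Hermitian

variable {𝔸 : Type*} [Ring 𝔸] [Algebra ℂ 𝔸] [StarRing 𝔸] [StarModule ℂ 𝔸] {S : Type*} {ι : Type*}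
variable (T : ι → Equiv.Perm S) (U : ι → S → 𝔸ˣ)

omit [Algebra ℂ 𝔸] [StarModule ℂ 𝔸] in
/-- For `W⁻¹ = W*` the transport commutes with the involution: `(R(W)X)* = R(W)X*`. [folklore] -/
theorem star_R {W : 𝔸ˣ} (hW : ((W⁻¹ : 𝔸ˣ) : 𝔸) = star (W : 𝔸)) (X : 𝔸) : star (R W X) = R W (star X) := by
  simp only [R, hW, star_mul, star_star, mul_assoc]

omit [Algebra ℂ 𝔸] [StarModule ℂ 𝔸] in
/-- `W⁻¹ = W*` passes to the inverse … [folklore] -/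
theorem unitary_inv {W : 𝔸ˣ} (hW : ((W⁻¹ : 𝔸ˣ) : 𝔸) = star (W : 𝔸)) :
    (((W⁻¹)⁻¹ : 𝔸ˣ) : 𝔸) = star ((W⁻¹ : 𝔸ˣ) : 𝔸) := by
  rw [inv_inv, hW, star_star]

omit [Algebra ℂ 𝔸] [StarModule ℂ 𝔸] in
/-- … and to products. [folklore] -/
theorem unitary_mul {V W : 𝔸ˣ} (hV : ((V⁻¹ : 𝔸ˣ) : 𝔸) = star (V : 𝔸)) (hW : ((W⁻¹ : 𝔸ˣ) : 𝔸) = star (W : 𝔸)) :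
    (((V * W)⁻¹ : 𝔸ˣ) : 𝔸) = star ((V * W : 𝔸ˣ) : 𝔸) := by
  rw [mul_inv_rev, Units.val_mul, Units.val_mul, hV, hW, star_mul]

omit [Algebra ℂ 𝔸] [StarModule ℂ 𝔸] in
/-- On the group the plaquette variable is unitary: `U(∂p)⁻¹ = U(∂p)*` («For U with values in the unitary group U(N)»).
[folklore] [cite: Balaban1985BackgroundPropagators, (3.5) p.391, p.392] -/
theorem plaqU_unitary (hU : ∀ μ x, (((U μ x)⁻¹ : 𝔸ˣ) : 𝔸) = star (U μ x : 𝔸)) (μ ν : ι) (x : S) :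
    (((plaqU T U μ ν x)⁻¹ : 𝔸ˣ) : 𝔸) = star (plaqU T U μ ν x : 𝔸) := by
  unfold plaqU
  exact unitary_mul (unitary_mul (unitary_mul (hU μ x) (hU ν _)) (unitary_inv (hU μ _))) (unitary_inv (hU ν x))

omit [Algebra ℂ 𝔸] [StarModule ℂ 𝔸] in
/-- `(D_μ f)* = D_μ(f*)` pointwise. [folklore] -/
theorem star_covD (hU : ∀ μ x, (((U μ x)⁻¹ : 𝔸ˣ) : 𝔸) = star (U μ x : 𝔸)) (μ : ι) (f : S → 𝔸) (x : S) :
    star (covD T U μ f x) = covD T U μ (star f) x := by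
  simp only [covD, star_sub, star_R (hU μ x), Pi.star_apply]

omit [Algebra ℂ 𝔸] [StarModule ℂ 𝔸] in
/-- `(D*_μ G)* = D*_μ(G*)` pointwise. [folklore] -/
theorem star_covDstar (hU : ∀ μ x, (((U μ x)⁻¹ : 𝔸ˣ) : 𝔸) = star (U μ x : 𝔸)) (μ : ι) (G : S → 𝔸) (x : S) :
    star (covDstar T U μ G x) = covDstar T U μ (star G) x := by
  simp only [covDstar, star_sub, star_R (unitary_inv (hU μ _)), Pi.star_apply]

omit [Algebra ℂ 𝔸] [StarModule ℂ 𝔸] in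
/-- `((D_U A)(p))* = (D_U A*)(p)`. [folklore] -/
theorem star_curl (hU : ∀ μ x, (((U μ x)⁻¹ : 𝔸ˣ) : 𝔸) = star (U μ x : 𝔸)) (A : ι → S → 𝔸) (μ ν : ι) (x : S) :
    star (curl T U A μ ν x) = curl T U (star A) μ ν x := by
  simp only [curl, covD, star_sub, star_R (hU _ _), Pi.star_apply]

omit [Algebra ℂ 𝔸] [StarModule ℂ 𝔸] in
/-- `(if p then a else 0)* = if p then a* else 0`. [folklore] -/
theorem star_if_zero (p : Prop) [Decidable p] (a : 𝔸) : star (if p then a else 0) = if p then star a else 0 := by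
  rw [apply_ite star, star_zero]

omit [Algebra ℂ 𝔸] [StarModule ℂ 𝔸] in
/-- `(÷(G₁,…,G₄))* = ÷(G₁*,…,G₄*)` pointwise. [folklore] -/
theorem star_divL [Fintype ι] [LinearOrder ι] (hU : ∀ μ x, (((U μ x)⁻¹ : 𝔸ˣ) : 𝔸) = star (U μ x : 𝔸))
    (G₁ G₂ G₃ G₄ : ι → ι → S → 𝔸) (μ : ι) (x : S) :
    star (divL T U G₁ G₂ G₃ G₄ μ x) = divL T U (star G₁) (star G₂) (star G₃) (star G₄) μ x := by
  simp only [divL, star_sub, star_sum, star_if_zero, star_R (unitary_inv (hU _ _)), Pi.star_apply]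

omit [Algebra ℂ 𝔸] [StarModule ℂ 𝔸] in
/-- `(D*F)* = D*(F*)` pointwise. [folklore] -/
theorem star_divP [Fintype ι] [LinearOrder ι] (hU : ∀ μ x, (((U μ x)⁻¹ : 𝔸ˣ) : 𝔸) = star (U μ x : 𝔸))
    (F : ι → ι → S → 𝔸) (μ : ι) (x : S) : star (divP T U F μ x) = divP T U (star F) μ x := by
  rw [← divL_self, star_divL T U hU, divL_self]

/-- A real scalar power is fixed by the involution of `ℂ`: `((η⁻¹)²)* = (η⁻¹)²`. [folklore] -/
theorem star_eta_sq (η : ℝ) : star (((η : ℂ)⁻¹) ^ 2) = ((η : ℂ)⁻¹) ^ 2 := by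
  rw [Complex.star_def, map_pow, map_inv₀, Complex.conj_ofReal]

/-- On the group `z(p)* = z(p)` (`B9Eq37Insertion.star_reC` BY NAME). [folklore] -/
theorem star_zP (hU : ∀ μ x, (((U μ x)⁻¹ : 𝔸ˣ) : 𝔸) = star (U μ x : 𝔸)) (η : ℝ) (μ ν : ι) (x : S) :
    star (zP T U η μ ν x) = zP T U η μ ν x := by
  rw [zP, star_smul, star_sub, star_one, star_reC (plaqU_unitary T U hU μ ν x), star_eta_sq]

/-- On the group `y(p)* = y(p)` (`B9Eq37Insertion.star_imC` BY NAME). [folklore] -/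
theorem star_yP (hU : ∀ μ x, (((U μ x)⁻¹ : 𝔸ˣ) : 𝔸) = star (U μ x : 𝔸)) (η : ℝ) (μ ν : ι) (x : S) :
    star (yP T U η μ ν x) = yP T U η μ ν x := by
  rw [yP, star_smul, star_imC (plaqU_unitary T U hU μ ν x), star_eta_sq]

/-- `(F^J_A(p))* = F^J_{A*}(p)` — this is where the Jordan symmetrisation is needed. [folklore] -/
theorem star_jordanF (hU : ∀ μ x, (((U μ x)⁻¹ : 𝔸ˣ) : 𝔸) = star (U μ x : 𝔸)) (η : ℝ) (A : ι → S → 𝔸) :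
    star (jordanF T U η A) = jordanF T U η (star A) := by
  funext μ ν x
  have h2 : star ((2 : ℂ)⁻¹) = (2 : ℂ)⁻¹ := by rw [Complex.star_def, map_inv₀, map_ofNat]
  show star (jordanF T U η A μ ν x) = jordanF T U η (star A) μ ν x
  unfold jordanF
  rw [star_smul, h2, star_add, star_mul, star_mul, star_curl T U hU, star_zP T U hU, add_comm]

omit [Algebra ℂ 𝔸] [StarModule ℂ 𝔸] in
/-- The signed partner sums commute with `*`. [folklore] -/
theorem star_sgnSum (hU : ∀ μ x, (((U μ x)⁻¹ : 𝔸ˣ) : 𝔸) = star (U μ x : 𝔸)) (A : ι → S → 𝔸) (μ ν : ι)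
    (x : S) :
    star (sgnSum₁ T U A μ ν x) = sgnSum₁ T U (star A) μ ν x ∧ star (sgnSum₂ T U A μ ν x) = sgnSum₂ T U (star A) μ ν x
      ∧ star (sgnSum₃ T U A μ ν x) = sgnSum₃ T U (star A) μ ν x
      ∧ star (sgnSum₄ T U A μ ν x) = sgnSum₄ T U (star A) μ ν x := by
  refine ⟨?_, ?_, ?_, ?_⟩ <;>
    simp only [sgnSum₁, sgnSum₂, sgnSum₃, sgnSum₄, star_neg, star_add, star_sub, star_R (hU _ _), Pi.star_apply]

/-- `(i/2)* = −i/2`. [folklore] -/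
theorem star_I_half : star (I / 2) = -(I / 2) := by
  rw [Complex.star_def, map_div₀, Complex.conj_I, map_ofNat, neg_div]

/-- `(G_k)_A(p)* = (G_k)_{A*}(p)`: `((i/2)[y,S])* = (−i/2)(S*y − yS*) = (i/2)[y,S*]` on the group. [folklore] -/
theorem star_commG (hU : ∀ μ x, (((U μ x)⁻¹ : 𝔸ˣ) : 𝔸) = star (U μ x : 𝔸)) (η : ℝ) (A : ι → S → 𝔸) :
    star (commG₁ T U η A) = commG₁ T U η (star A) ∧ star (commG₂ T U η A) = commG₂ T U η (star A)
      ∧ star (commG₃ T U η A) = commG₃ T U η (star A) ∧ star (commG₄ T U η A) = commG₄ T U η (star A) := by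
  refine ⟨?_, ?_, ?_, ?_⟩
  all_goals
    funext μ ν x
    obtain ⟨h₁, h₂, h₃, h₄⟩ := star_sgnSum T U hU A μ ν x
    first
    | show star (commG₁ T U η A μ ν x) = commG₁ T U η (star A) μ ν x
    | show star (commG₂ T U η A μ ν x) = commG₂ T U η (star A) μ ν x
    | show star (commG₃ T U η A μ ν x) = commG₃ T U η (star A) μ ν x
    | show star (commG₄ T U η A μ ν x) = commG₄ T U η (star A) μ ν x
    simp only [commG₁, commG₂, commG₃, commG₄, star_smul, star_I_half, star_sub, star_mul, star_yP T U hU, h₁, h₂, h₃,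
      h₄, neg_smul, ← smul_neg, neg_sub]

variable [Fintype ι] [LinearOrder ι]

/-- **`Δ′` COMMUTES WITH THE INVOLUTION** on the group: `((Δ′A)(b))* = (Δ′(A*))(b)`. [folklore]
[cite: Balaban1985BackgroundPropagators, (3.10) p.392] -/
theorem star_deltaPrimeOp (hU : ∀ μ x, (((U μ x)⁻¹ : 𝔸ˣ) : 𝔸) = star (U μ x : 𝔸)) (η : ℝ) (A : ι → S → 𝔸)
    (μ : ι) (x : S) : star (deltaPrimeOp T U η A μ x) = deltaPrimeOp T U η (star A) μ x := by
  obtain ⟨h₁, h₂, h₃, h₄⟩ := star_commG T U hU η A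
  rw [deltaPrimeOp, star_add, star_divP T U hU, star_jordanF T U hU, star_divL T U hU, h₁, h₂, h₃, h₄, deltaPrimeOp]

/-- A real scalar is fixed by the involution of `ℂ`: `(η⁻¹)* = η⁻¹`. [folklore] -/
theorem star_eta_inv (η : ℝ) : star ((η : ℂ)⁻¹) = (η : ℂ)⁻¹ := by
  rw [Complex.star_def, map_inv₀, Complex.conj_ofReal]

omit [Fintype ι] [LinearOrder ι] in
/-- `(D^η_U A)* = D^η_U(A*)`. [folklore] -/
theorem star_curlη (hU : ∀ μ x, (((U μ x)⁻¹ : 𝔸ˣ) : 𝔸) = star (U μ x : 𝔸)) (η : ℝ) (A : ι → S → 𝔸) :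
    star (curlη T U η A) = curlη T U η (star A) := by
  funext κ ν y
  show star (curlη T U η A κ ν y) = curlη T U η (star A) κ ν y
  rw [curlη, curlη, star_smul, star_eta_inv, star_curl T U hU]

/-- **`Δ` COMMUTES WITH THE INVOLUTION** on the group: `((ΔA)(b))* = (Δ(A*))(b)`; in particular `Δ` maps hermitian bond fields
(`A(b)* = A(b)`, the «functions with values in N × N hermitian matrices» of p. 391) to hermitian bond fields
(`deltaOp_selfAdjoint`). [folklore] [cite: Balaban1985BackgroundPropagators, (3.10) p.392, p.391] -/
theorem star_deltaOp (hU : ∀ μ x, (((U μ x)⁻¹ : 𝔸ˣ) : 𝔸) = star (U μ x : 𝔸)) (η : ℝ) (A : ι → S → 𝔸) (μ : ι)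
    (x : S) : star (deltaOp T U η A μ x) = deltaOp T U η (star A) μ x := by
  rw [deltaOp, star_add, divPη, star_smul, star_eta_inv, star_divP T U hU, star_curlη T U hU,
    star_deltaPrimeOp T U hU, deltaOp, divPη]

/-- `Δ′` preserves hermitian bond fields on the group. [folklore] -/
theorem deltaPrimeOp_selfAdjoint (hU : ∀ μ x, (((U μ x)⁻¹ : 𝔸ˣ) : 𝔸) = star (U μ x : 𝔸)) (η : ℝ)
    {A : ι → S → 𝔸} (hA : ∀ μ x, star (A μ x) = A μ x) (μ : ι) (x : S) :
    star (deltaPrimeOp T U η A μ x) = deltaPrimeOp T U η A μ x := by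
  have hA' : star A = A := funext fun μ => funext fun x => hA μ x
  rw [star_deltaPrimeOp T U hU, hA']

/-- `Δ` preserves hermitian bond fields on the group. [folklore] [cite: Balaban1985BackgroundPropagators, (3.10) p.392] -/
theorem deltaOp_selfAdjoint (hU : ∀ μ x, (((U μ x)⁻¹ : 𝔸ˣ) : 𝔸) = star (U μ x : 𝔸)) (η : ℝ) {A : ι → S → 𝔸}
    (hA : ∀ μ x, star (A μ x) = A μ x) (μ : ι) (x : S) : star (deltaOp T U η A μ x) = deltaOp T U η A μ x := by
  have hA' : star A = A := funext fun μ => funext fun x => hA μ x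
  rw [star_deltaOp T U hU, hA']

variable [Fintype S]

omit [StarModule ℂ 𝔸] [LinearOrder ι] in
/-- REALITY OF THE PAIRING (3.11) on hermitian fields: for a tracial `*`-compatible `τ` (`τ(a*) = conj τ(a)`, e.g. the matrix
trace) and `A(b)* = A(b)`, `E(b)* = E(b)`: `conj ⟨A,E⟩ = ⟨A,E⟩`. [folklore] [cite: Balaban1985BackgroundPropagators, (3.11) p.392] -/
theorem conj_bondPair (τ : 𝔸 →ₗ[ℂ] ℂ) (hτ : ∀ a b : 𝔸, τ (a * b) = τ (b * a))
    (hτs : ∀ a : 𝔸, τ (star a) = starRingEnd ℂ (τ a)) (η : ℝ) (d : ℕ) {A E : ι → S → 𝔸}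
    (hA : ∀ μ x, star (A μ x) = A μ x) (hE : ∀ μ x, star (E μ x) = E μ x) :
    starRingEnd ℂ (bondPair η d τ A E) = bondPair η d τ A E := by
  unfold bondPair
  rw [map_mul, map_pow, Complex.conj_ofReal, map_sum]
  congr 1
  refine Finset.sum_congr rfl fun x _ => ?_
  rw [map_sum]
  refine Finset.sum_congr rfl fun μ _ => ?_
  rw [← hτs, star_mul, hA, hE, hτ]

/-- **`⟨A, ΔA⟩` IS REAL** on the group for hermitian `A` and a tracial `*`-compatible `τ` — the form of a hermitian operator.
[folklore] [cite: Balaban1985BackgroundPropagators, (3.10) p.392] -/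
theorem conj_bondPair_deltaOp (hU : ∀ μ x, (((U μ x)⁻¹ : 𝔸ˣ) : 𝔸) = star (U μ x : 𝔸)) (τ : 𝔸 →ₗ[ℂ] ℂ)
    (hτ : ∀ a b : 𝔸, τ (a * b) = τ (b * a)) (hτs : ∀ a : 𝔸, τ (star a) = starRingEnd ℂ (τ a)) (η : ℝ) (d : ℕ)
    {A : ι → S → 𝔸} (hA : ∀ μ x, star (A μ x) = A μ x) :
    starRingEnd ℂ (bondPair η d τ A (deltaOp T U η A)) = bondPair η d τ A (deltaOp T U η A) :=
  conj_bondPair τ hτ hτs η d hA (deltaOp_selfAdjoint T U hU η hA)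

/-- The same for `Δ′`: `conj ⟨A, Δ′A⟩ = ⟨A, Δ′A⟩`. [folklore] -/
theorem conj_bondPair_deltaPrimeOp (hU : ∀ μ x, (((U μ x)⁻¹ : 𝔸ˣ) : 𝔸) = star (U μ x : 𝔸)) (τ : 𝔸 →ₗ[ℂ] ℂ)
    (hτ : ∀ a b : 𝔸, τ (a * b) = τ (b * a)) (hτs : ∀ a : 𝔸, τ (star a) = starRingEnd ℂ (τ a)) (η : ℝ) (d : ℕ)
    {A : ι → S → 𝔸} (hA : ∀ μ x, star (A μ x) = A μ x) :
    starRingEnd ℂ (bondPair η d τ A (deltaPrimeOp T U η A)) = bondPair η d τ A (deltaPrimeOp T U η A) :=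
  conj_bondPair τ hτ hτs η d hA (deltaPrimeOp_selfAdjoint T U hU η hA)

end Hermitian

section HermitianForm

variable {𝔸 : Type*} [NormedRing 𝔸] [NormedAlgebra ℂ 𝔸] [StarRing 𝔸] [StarModule ℂ 𝔸]
variable {S : Type*} [Fintype S] {ι : Type*} [Fintype ι] [LinearOrder ι]
variable (T : ι → Equiv.Perm S) (U : ι → S → 𝔸ˣ)

/-- **THE PRINTED QUADRATIC FORM (3.10) IS REAL** on the unitary group, for hermitian bond fields and a tracial `*`-compatible
`τ`: `conj ⟨A,ΔA⟩ = ⟨A,ΔA⟩` (`B9Eq39Adjoint.hessPair`). [folklore] [cite: Balaban1985BackgroundPropagators, (3.10) p.392] -/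
theorem conj_hessPair (hU : ∀ μ x, (((U μ x)⁻¹ : 𝔸ˣ) : 𝔸) = star (U μ x : 𝔸)) (τ : 𝔸 →ₗ[ℂ] ℂ)
    (hτ : ∀ a b : 𝔸, τ (a * b) = τ (b * a)) (hτs : ∀ a : 𝔸, τ (star a) = starRingEnd ℂ (τ a)) (η : ℝ) (d : ℕ)
    {A : ι → S → 𝔸} (hA : ∀ μ x, star (A μ x) = A μ x) :
    starRingEnd ℂ (hessPair T U η d τ A) = hessPair T U η d τ A := by
  rw [← bondPair_deltaOp_self T U τ hτ]
  exact conj_bondPair_deltaOp T U hU τ hτ hτs η d hA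

/-- … equivalently `Im ⟨A,ΔA⟩ = 0`. [folklore] [cite: Balaban1985BackgroundPropagators, (3.10) p.392] -/
theorem hessPair_im (hU : ∀ μ x, (((U μ x)⁻¹ : 𝔸ˣ) : 𝔸) = star (U μ x : 𝔸)) (τ : 𝔸 →ₗ[ℂ] ℂ)
    (hτ : ∀ a b : 𝔸, τ (a * b) = τ (b * a)) (hτs : ∀ a : 𝔸, τ (star a) = starRingEnd ℂ (τ a)) (η : ℝ) (d : ℕ)
    {A : ι → S → 𝔸} (hA : ∀ μ x, star (A μ x) = A μ x) : (hessPair T U η d τ A).im = 0 :=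
  Complex.conj_eq_iff_im.mp (conj_hessPair T U hU τ hτ hτs η d hA)

/-- … and `Im ⟨A,Δ′A⟩ = 0` (`B9Eq39Adjoint.deltaPrime`). [folklore] -/
theorem deltaPrime_im (hU : ∀ μ x, (((U μ x)⁻¹ : 𝔸ˣ) : 𝔸) = star (U μ x : 𝔸)) (τ : 𝔸 →ₗ[ℂ] ℂ)
    (hτ : ∀ a b : 𝔸, τ (a * b) = τ (b * a)) (hτs : ∀ a : 𝔸, τ (star a) = starRingEnd ℂ (τ a)) (η : ℝ) (d : ℕ)
    {A : ι → S → 𝔸} (hA : ∀ μ x, star (A μ x) = A μ x) : (deltaPrime T U η d τ A).im = 0 := by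
  rw [← bondPair_deltaPrimeOp_self T U τ hτ]
  exact Complex.conj_eq_iff_im.mp (conj_bondPair_deltaPrimeOp T U hU τ hτ hτs η d hA)

end HermitianForm

/-! ## §5  `Δ′` IS BOUNDED AND SMALL when `η⁻²|U(∂p) − 1|` is small («a bounded, small operator») -/

section Bound

variable {𝔸 : Type*} [NormedRing 𝔸] [NormedAlgebra ℂ 𝔸] {S : Type*} {ι : Type*}
variable (T : ι → Equiv.Perm S) (U : ι → S → 𝔸ˣ)

omit [NormedAlgebra ℂ 𝔸] in
/-- Transport by a unit of norm `≤ 1` with inverse of norm `≤ 1` (a unitary matrix in the operator norm) does not increase the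
norm: `‖R(W)X‖ ≤ ‖X‖`. [folklore] -/
theorem norm_R_le {W : 𝔸ˣ} (h₁ : ‖(W : 𝔸)‖ ≤ 1) (h₂ : ‖((W⁻¹ : 𝔸ˣ) : 𝔸)‖ ≤ 1) (X : 𝔸) : ‖R W X‖ ≤ ‖X‖ := by
  unfold R
  calc ‖(W : 𝔸) * X * ((W⁻¹ : 𝔸ˣ) : 𝔸)‖
      ≤ ‖(W : 𝔸)‖ * ‖X‖ * ‖((W⁻¹ : 𝔸ˣ) : 𝔸)‖ :=
        (norm_mul_le _ _).trans (mul_le_mul_of_nonneg_right (norm_mul_le _ _) (norm_nonneg _))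
    _ ≤ 1 * ‖X‖ * 1 := by gcongr
    _ = ‖X‖ := by ring

omit [NormedAlgebra ℂ 𝔸] in
/-- … nor does transport by the inverse. [folklore] -/
theorem norm_R_inv_le {W : 𝔸ˣ} (h₁ : ‖(W : 𝔸)‖ ≤ 1) (h₂ : ‖((W⁻¹ : 𝔸ˣ) : 𝔸)‖ ≤ 1) (X : 𝔸) :
    ‖R W⁻¹ X‖ ≤ ‖X‖ :=
  norm_R_le h₂ (by rw [inv_inv]; exact h₁) X

/-- `‖½(cz + zc)‖ ≤ s·δ` for `‖c‖ ≤ s`, `‖z‖ ≤ δ`. [folklore] -/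
theorem norm_jordan_smul_le {c z : 𝔸} {s δ : ℝ} (hc : ‖c‖ ≤ s) (hz : ‖z‖ ≤ δ) :
    ‖(2 : ℂ)⁻¹ • (c * z + z * c)‖ ≤ s * δ := by
  have hs : 0 ≤ s := (norm_nonneg _).trans hc
  have hδ : 0 ≤ δ := (norm_nonneg _).trans hz
  have h2 : ‖(2 : ℂ)⁻¹‖ = 2⁻¹ := by rw [norm_inv, Complex.norm_two]
  have e : ‖c * z + z * c‖ ≤ s * δ + δ * s :=
    norm_add_le_of_le ((norm_mul_le _ _).trans (mul_le_mul hc hz (norm_nonneg _) hs))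
      ((norm_mul_le _ _).trans (mul_le_mul hz hc (norm_nonneg _) hδ))
  rw [norm_smul, h2]
  linarith

/-- `‖(i/2)(yX − Xy)‖ ≤ s·δ` for `‖X‖ ≤ s`, `‖y‖ ≤ δ`. [folklore] -/
theorem norm_comm_smul_le {y X : 𝔸} {s δ : ℝ} (hX : ‖X‖ ≤ s) (hy : ‖y‖ ≤ δ) :
    ‖(I / 2) • (y * X - X * y)‖ ≤ s * δ := by
  have hs : 0 ≤ s := (norm_nonneg _).trans hX
  have hδ : 0 ≤ δ := (norm_nonneg _).trans hy
  have hI : ‖I / 2‖ = 2⁻¹ := by rw [norm_div, Complex.norm_I, Complex.norm_two, one_div]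
  have e : ‖y * X - X * y‖ ≤ δ * s + s * δ :=
    norm_sub_le_of_le ((norm_mul_le _ _).trans (mul_le_mul hy hX (norm_nonneg _) hδ))
      ((norm_mul_le _ _).trans (mul_le_mul hX hy (norm_nonneg _) hs))
  rw [norm_smul, hI]
  linarith

omit [NormedAlgebra ℂ 𝔸] in
/-- `‖(D_U A)(p)‖ ≤ 4a` for `‖A(b)‖ ≤ a` and norm-`≤ 1` units. [folklore] -/
theorem norm_curl_le (hU1 : ∀ μ x, ‖(U μ x : 𝔸)‖ ≤ 1 ∧ ‖(((U μ x)⁻¹ : 𝔸ˣ) : 𝔸)‖ ≤ 1) {A : ι → S → 𝔸} {a : ℝ}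
    (hA : ∀ μ x, ‖A μ x‖ ≤ a) (μ ν : ι) (x : S) : ‖curl T U A μ ν x‖ ≤ 4 * a := by
  have h1 : ‖R (U μ x) (A ν (T μ x))‖ ≤ a := (norm_R_le (hU1 μ x).1 (hU1 μ x).2 _).trans (hA _ _)
  have h2 : ‖R (U ν x) (A μ (T ν x))‖ ≤ a := (norm_R_le (hU1 ν x).1 (hU1 ν x).2 _).trans (hA _ _)
  exact (norm_sub_le_of_le (norm_sub_le_of_le h1 (hA ν x)) (norm_sub_le_of_le h2 (hA μ x))).trans
    (le_of_eq (by ring))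

omit [NormedAlgebra ℂ 𝔸] in
/-- `‖S_k(p)‖ ≤ 3a` for the signed partner sums. [folklore] -/
theorem norm_sgnSum_le (hU1 : ∀ μ x, ‖(U μ x : 𝔸)‖ ≤ 1 ∧ ‖(((U μ x)⁻¹ : 𝔸ˣ) : 𝔸)‖ ≤ 1) {A : ι → S → 𝔸}
    {a : ℝ} (hA : ∀ μ x, ‖A μ x‖ ≤ a) (μ ν : ι) (x : S) :
    ‖sgnSum₁ T U A μ ν x‖ ≤ 3 * a ∧ ‖sgnSum₂ T U A μ ν x‖ ≤ 3 * a ∧ ‖sgnSum₃ T U A μ ν x‖ ≤ 3 * a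
      ∧ ‖sgnSum₄ T U A μ ν x‖ ≤ 3 * a := by
  have h₁ : ‖-(R (U ν x) (A μ (T ν x)))‖ ≤ a := by
    rw [norm_neg]; exact (norm_R_le (hU1 ν x).1 (hU1 ν x).2 _).trans (hA _ _)
  have h₂ : ‖-(A ν x)‖ ≤ a := by rw [norm_neg]; exact hA ν x
  have h₃ : ‖A μ x‖ ≤ a := hA μ x
  have h₄ : ‖R (U μ x) (A ν (T μ x))‖ ≤ a := (norm_R_le (hU1 μ x).1 (hU1 μ x).2 _).trans (hA _ _)
  refine ⟨?_, ?_, ?_, ?_⟩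
  · rw [sgnSum₁, norm_neg]
    exact (norm_add_le_of_le (norm_add_le_of_le h₂ h₃) h₄).trans (le_of_eq (by ring))
  · exact (norm_sub_le_of_le h₁ (norm_add_le_of_le h₃ h₄)).trans (le_of_eq (by ring))
  · exact (norm_sub_le_of_le (norm_add_le_of_le h₁ h₂) h₄).trans (le_of_eq (by ring))
  · exact (norm_add_le_of_le (norm_add_le_of_le h₁ h₂) h₃).trans (le_of_eq (by ring))

variable [LinearOrder ι]

/-- `‖F^J_A(p)‖ ≤ 4aδ` on positively oriented plaquettes, where `δ` bounds `‖z(p)‖ = η⁻²‖Re U(∂p) − 1‖`. [folklore]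
[cite: Balaban1985BackgroundPropagators, (3.10) p.392] -/
theorem norm_jordanF_le (hU1 : ∀ μ x, ‖(U μ x : 𝔸)‖ ≤ 1 ∧ ‖(((U μ x)⁻¹ : 𝔸ˣ) : 𝔸)‖ ≤ 1) {A : ι → S → 𝔸}
    {a : ℝ} (hA : ∀ μ x, ‖A μ x‖ ≤ a) {η δ : ℝ} (hz : ∀ μ ν x, μ < ν → ‖zP T U η μ ν x‖ ≤ δ)
    {μ ν : ι} (h : μ < ν) (x : S) : ‖jordanF T U η A μ ν x‖ ≤ 4 * a * δ :=
  norm_jordan_smul_le (norm_curl_le T U hU1 hA μ ν x) (hz μ ν x h)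

/-- `‖(G_k)_A(p)‖ ≤ 3aδ` on positively oriented plaquettes, where `δ` bounds `‖y(p)‖ = η⁻²‖Im U(∂p)‖`. [folklore]
[cite: Balaban1985BackgroundPropagators, (3.10) p.392] -/
theorem norm_commG_le (hU1 : ∀ μ x, ‖(U μ x : 𝔸)‖ ≤ 1 ∧ ‖(((U μ x)⁻¹ : 𝔸ˣ) : 𝔸)‖ ≤ 1) {A : ι → S → 𝔸}
    {a : ℝ} (hA : ∀ μ x, ‖A μ x‖ ≤ a) {η δ : ℝ} (hy : ∀ μ ν x, μ < ν → ‖yP T U η μ ν x‖ ≤ δ)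
    {μ ν : ι} (h : μ < ν) (x : S) :
    ‖commG₁ T U η A μ ν x‖ ≤ 3 * a * δ ∧ ‖commG₂ T U η A μ ν x‖ ≤ 3 * a * δ
      ∧ ‖commG₃ T U η A μ ν x‖ ≤ 3 * a * δ ∧ ‖commG₄ T U η A μ ν x‖ ≤ 3 * a * δ := by
  obtain ⟨h₁, h₂, h₃, h₄⟩ := norm_sgnSum_le T U hU1 hA μ ν x
  exact ⟨norm_comm_smul_le h₁ (hy μ ν x h), norm_comm_smul_le h₂ (hy μ ν x h), norm_comm_smul_le h₃ (hy μ ν x h),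
    norm_comm_smul_le h₄ (hy μ ν x h)⟩

variable [Fintype ι]

/-- PLAQUETTES THROUGH A BOND: `#{ν : ν < μ} + #{ν : μ < ν} = d − 1` (`d = |ι|`), as the weighted count
`Σ_{ν<μ} c + Σ_{ν>μ} c = c(d − 1)`. [folklore] -/
theorem sum_ite_lt_add_sum_ite_gt (μ : ι) (c : ℝ) :
    ((∑ ν, if ν < μ then c else 0) + ∑ ν, if μ < ν then c else 0) = c * ((Fintype.card ι - 1 : ℕ) : ℝ) := by
  rw [← Finset.sum_add_distrib]
  have e : ∀ ν, ((if ν < μ then c else 0) + if μ < ν then c else 0) = if ν ≠ μ then c else 0 := by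
    intro ν
    rcases lt_trichotomy ν μ with h | h | h
    · rw [if_pos h, if_neg (not_lt.mpr h.le), if_pos h.ne, add_zero]
    · rw [if_neg (lt_irrefl _ |> (h ▸ ·)), if_neg (h ▸ lt_irrefl _), if_neg (fun hn => hn h), add_zero]
    · rw [if_neg (not_lt.mpr h.le), if_pos h, if_pos h.ne', zero_add]
  simp only [e]
  rw [Finset.sum_ite, Finset.sum_const_zero, add_zero, Finset.sum_const, Finset.filter_ne',
    Finset.card_erase_of_mem (Finset.mem_univ μ), Finset.card_univ, nsmul_eq_mul, mul_comm]

omit [NormedAlgebra ℂ 𝔸] in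
/-- `‖(÷G)(b)‖ ≤ 2g(d − 1)` for `‖G_k(p)‖ ≤ g` on positively oriented plaquettes. [folklore] -/
theorem norm_divL_le (hU1 : ∀ μ x, ‖(U μ x : 𝔸)‖ ≤ 1 ∧ ‖(((U μ x)⁻¹ : 𝔸ˣ) : 𝔸)‖ ≤ 1)
    {G₁ G₂ G₃ G₄ : ι → ι → S → 𝔸} {g : ℝ}
    (hG : ∀ μ ν x, μ < ν → ‖G₁ μ ν x‖ ≤ g ∧ ‖G₂ μ ν x‖ ≤ g ∧ ‖G₃ μ ν x‖ ≤ g ∧ ‖G₄ μ ν x‖ ≤ g) (μ : ι) (x : S) :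
    ‖divL T U G₁ G₂ G₃ G₄ μ x‖ ≤ 2 * g * ((Fintype.card ι - 1 : ℕ) : ℝ) := by
  have h1 : ∀ ν, ‖(if ν < μ then R (U ν ((T ν).symm x))⁻¹ (G₄ ν μ ((T ν).symm x)) - G₂ ν μ x else 0)‖
      ≤ if ν < μ then 2 * g else 0 := by
    intro ν
    split_ifs with h
    · exact (norm_sub_le_of_le ((norm_R_inv_le (hU1 _ _).1 (hU1 _ _).2 _).trans (hG ν μ _ h).2.2.2)
        (hG ν μ x h).2.1).trans (le_of_eq (by ring))
    · rw [norm_zero]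
  have h2 : ∀ ν, ‖(if μ < ν then R (U ν ((T ν).symm x))⁻¹ (G₁ μ ν ((T ν).symm x)) - G₃ μ ν x else 0)‖
      ≤ if μ < ν then 2 * g else 0 := by
    intro ν
    split_ifs with h
    · exact (norm_sub_le_of_le ((norm_R_inv_le (hU1 _ _).1 (hU1 _ _).2 _).trans (hG μ ν _ h).1)
        (hG μ ν x h).2.2.1).trans (le_of_eq (by ring))
    · rw [norm_zero]
  unfold divL
  refine (norm_sub_le _ _).trans ?_
  refine (add_le_add ((norm_sum_le _ _).trans (Finset.sum_le_sum fun ν _ => h1 ν))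
    ((norm_sum_le _ _).trans (Finset.sum_le_sum fun ν _ => h2 ν))).trans ?_
  rw [sum_ite_lt_add_sum_ite_gt μ (2 * g)]

omit [NormedAlgebra ℂ 𝔸] in
/-- `‖(D*F)(b)‖ ≤ 2f(d − 1)` for `‖F(p)‖ ≤ f` on positively oriented plaquettes. [folklore]
[cite: Balaban1985BackgroundPropagators, (3.9) p.392] -/
theorem norm_divP_le (hU1 : ∀ μ x, ‖(U μ x : 𝔸)‖ ≤ 1 ∧ ‖(((U μ x)⁻¹ : 𝔸ˣ) : 𝔸)‖ ≤ 1)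
    {F : ι → ι → S → 𝔸} {f : ℝ} (hF : ∀ μ ν x, μ < ν → ‖F μ ν x‖ ≤ f) (μ : ι) (x : S) :
    ‖divP T U F μ x‖ ≤ 2 * f * ((Fintype.card ι - 1 : ℕ) : ℝ) := by
  rw [← divL_self]
  exact norm_divL_le T U hU1 (fun μ ν x h => ⟨hF μ ν x h, hF μ ν x h, hF μ ν x h, hF μ ν x h⟩) μ x

/-- **`Δ′` IS A BOUNDED, SMALL OPERATOR** (sup norm on bond fields): if the units have norm `≤ 1` with inverses of norm `≤ 1`
(unitary matrices in the operator norm), `‖A(b)‖ ≤ a`, and on every positively oriented plaquette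
`η⁻²‖Re U(∂p) − 1‖ ≤ δ` and `η⁻²‖Im U(∂p)‖ ≤ δ`, then `‖(Δ′A)(b)‖ ≤ 14(d − 1)·a·δ` at every bond — «with our assumptions on
the configuration U the operator Δ′ will be a bounded, small operator, which will be treated as a small perturbation of
D*D» (p. 392; the smallness `δ` is what (3.35), p. 396, provides — quoted as the source of the hypothesis, not derived here).
[folklore] [cite: Balaban1985BackgroundPropagators, (3.10) p.392, (3.35) p.396] -/
theorem norm_deltaPrimeOp_le (hU1 : ∀ μ x, ‖(U μ x : 𝔸)‖ ≤ 1 ∧ ‖(((U μ x)⁻¹ : 𝔸ˣ) : 𝔸)‖ ≤ 1)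
    {A : ι → S → 𝔸} {a : ℝ} (hA : ∀ μ x, ‖A μ x‖ ≤ a) {η δ : ℝ}
    (hz : ∀ μ ν x, μ < ν → ‖zP T U η μ ν x‖ ≤ δ) (hy : ∀ μ ν x, μ < ν → ‖yP T U η μ ν x‖ ≤ δ) (μ : ι) (x : S) :
    ‖deltaPrimeOp T U η A μ x‖ ≤ 14 * (a * δ) * ((Fintype.card ι - 1 : ℕ) : ℝ) := by
  have hJ : ∀ μ ν x, μ < ν → ‖jordanF T U η A μ ν x‖ ≤ 4 * a * δ := fun μ ν x h =>
    norm_jordanF_le T U hU1 hA hz h x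
  have hG : ∀ μ ν x, μ < ν → ‖commG₁ T U η A μ ν x‖ ≤ 3 * a * δ ∧ ‖commG₂ T U η A μ ν x‖ ≤ 3 * a * δ
      ∧ ‖commG₃ T U η A μ ν x‖ ≤ 3 * a * δ ∧ ‖commG₄ T U η A μ ν x‖ ≤ 3 * a * δ := fun μ ν x h =>
    norm_commG_le T U hU1 hA hy h x
  unfold deltaPrimeOp
  exact (norm_add_le_of_le (norm_divP_le T U hU1 hJ μ x) (norm_divL_le T U hU1 hG μ x)).trans (le_of_eq (by ring))

end Bound

/-! ## §6  Sanity: the trivial background -/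

section Examples

variable {𝔸 : Type*} [Ring 𝔸] [Algebra ℂ 𝔸] {S : Type*} {ι : Type*} [Fintype ι] [LinearOrder ι]
variable (T : ι → Equiv.Perm S)

/-- SANITY (`U ≡ 1`, the flat background): `U(∂p) = 1`, so both weights vanish, `z(p) = 0 = y(p)` … [folklore] -/
example (η : ℝ) (μ ν : ι) (x : S) :
    zP T (fun _ _ => (1 : 𝔸ˣ)) η μ ν x = 0 ∧ yP T (fun _ _ => (1 : 𝔸ˣ)) η μ ν x = 0 := by
  simp [zP, yP, plaqU]

/-- … hence `Δ′ = 0`: in the flat background `Δ = D*D` is the (covariant = ordinary) vector Laplacian form, the «operator ∂*∂ in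
the Abelian case» which `Δ` generalises (p. 392). [folklore] [cite: Balaban1985BackgroundPropagators, (3.10) p.392] -/
example (η : ℝ) (A : ι → S → 𝔸) (μ : ι) (x : S) : deltaPrimeOp T (fun _ _ => (1 : 𝔸ˣ)) η A μ x = 0 := by
  simp [deltaPrimeOp, divP, divL, covDstar, jordanF, commG₁, commG₂, commG₃, commG₄, zP, yP, plaqU, R]

end Examples

end Literature.MathematicalPhysics.QuantumFieldTheory.Balaban1983to89.B9Eq310Hermitian
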